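import Literature.MathematicalPhysics.QuantumFieldTheory.Federbush1986.NonAbelianDualityClosedSubgroup
import Literature.MathematicalPhysics.QuantumFieldTheory.Federbush1986.LocalStabilityGLemma56

/-!
# `Federbush1986.PureAveragesClosedSubgroup` — [Federbush1987PhaseCellIII] §1 (pure averages, Lemmas 1.0–1.3), Proposition
# 5.9, §1's chart data, and the Regime-1 chain (5.18)–(5.20) / (5.25) / Local Stability Theorem 4.3 for the MODEL INSTANCE
# `G = H`, EVERY CLOSED, LOCALLY EXPONENTIAL SUBGROUP `H ≤ U(N)` — in particular (Cartan–von Neumann, `NonAbelianDualityClosedSubgroup`)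
# EVERY CLOSED SUBGROUP OF `U(N)` (theorems + two definitions with bodies: the local logarithm and the chart of `H`)

statement-level skeleton of published theorems with citation tags; proofs where landed; nothing here is a claim about the Yang–Mills mass gap

CITATION HEADER.  P. Federbush, *A phase cell approach to Yang–Mills theory. III. Local stability, modified renormalization
group transformation*, Commun. Math. Phys. **110** (1987) 293–309 [Federbush1987PhaseCellIII] (cell paper F3): §1 p. 294–296
((1.1)–(1.3), Lemmas 1.0–1.3), Proposition 5.9 (5.16) p. 301–302, §5.2 (5.17)–(5.25) p. 302–303, Local Stability Theorem 4.3
(4.5) p. 299, (3.8) p. 297–298, Lemma 5.6 (5.13) p. 301; *VI*, AIHP **47** (1987) [Federbush1987PhaseCellVI] p. 18–19 («a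
compact simple Lie group, G», (5)).  lit-balaban cell (HOME `run/shared/lean/pub/lit-balaban/`), unit `lit-balaban-r17` gen 8
(reader/typer r17 = fold owner of the Federbush rows), SKELETON rows **F3.Lem1.0**, **F3.Lem1.1**, **F3.Lem1.2**, **F3.Lem1.3**,
**F3.Prop5.9**, **F3.Eq1.1-1.2**, **F3.Eq5.17-5.21**, **F3.Eq5.25**, **F3.Thm4.3**, **F3.Eq3.5-3.8**, **F3.Lem5.6** of
`HOME/lit-balaban-r17/SKELETON-r17.md`; statement file `PureAverages.lean` (r17) UNCHANGED.  Inputs BY NAME: the typed §1 packet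
`Lemma10Normalisation`, `Lemma11`, `Lemma12`, `Lemma13`, `Proposition59At`, `Proposition59`, `IsPureAverage`, `sumSqDist`,
`isPureAverage_iff_conj`, `exists_isPureAverage_of_compactSpace` (`PureAverages*`, r17/p32); their `U(N)` instances `UN.lemma10_UN`
(`PureAveragesUN`, p12 gen 6), `UN.lemma11_UN`, `UN.lemma12_UN`, `UN.lemma13_UN`, `UN.proposition59At_UN`,
`UN.existsUnique_isPureAverage`, `UN.exists_isPureAverage` (p12 gen 6 `PureAveragesUNLemma11/12/13Converse/Prop59`); the chart
`LocalLog` with `UN.localLog` and the group-generic Regime-1 theorems `LocalLog.fourAverages`, `LocalStabilityG.eq525_family`,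
`localStabilityTheorem43_family`, `eq525_familyM56`, `localStabilityTheorem43_familyM56` (p32 gens 7–8 `LocalLogChart`,
`LocalStabilityGFourAverages`, `LocalStabilityGEq525`, `LocalStabilityGLemma56`); the closed locally exponential subgroups
`UNLieSubgroup` with `mem_of_isPureAverage`, `sumSqDist_coe`, `isPureAverage_of_coe`, `expH`, the instances on `↥H`
(`NonAbelianDualityUNSubgroup`, this unit gen 7) and `UNLieSubgroup.ofClosed` (`NonAbelianDualityClosedSubgroup`, gen 8); Mathlib's
orthogonal projection `Submodule.orthogonalProjectionOnto`.

WHAT IS PRINTED.  III p. 294: «Let g_i, i = 1, …, n be n elements in a compact Lie Group, G … an invariant distance on G … we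
define an average ḡ … as the element minimizing Σ d²(ḡ, g_i) (1.2)»; Lemma 1.0 (1.3), Lemma 1.1 (1.4)–(1.5)/(1.11), Lemma
1.2 (1.10), Lemma 1.3 (1.12) p. 295–296; Proposition 5.9 (5.16) p. 301; (5.25) p. 303; Theorem 4.3 (4.5) p. 299.  VI p. 19:
«If u(g) = e^A … we may set d²(Id, g) = −Tr A² (5) for a unitary representations u(g)».

WHY THIS FILE (honest scope).  The typed §1 packet of `PureAverages.lean` was inhabited by hand for `SU(2)` (p32 g3–4), `U(N)`
(p12 g6) and `SU(N)` (p32 g8, central splitting of `U(N) = U(1)·SU(N)`).  This file inhabits it AT ONCE for every closed,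
locally exponential `H ≤ U(N)` (`D : UNLieSubgroup N`) — hence, by `UNLieSubgroup.ofClosed` (Cartan–von Neumann for `U(N)`,
gen 8), for EVERY CLOSED SUBGROUP OF `U(N)`, i.e. every compact Lie group presented with a faithful unitary representation
(print's «compact Lie Group G» with (5)).  The ONE step (§1, OUR proof from III §1): **an `H`-pure average of clustered
`H`-valued data is a `U(N)`-pure average** — the `U(N)`-pure average `g₀` of the data exists (compactness) and LIES IN `H`
(gen-7 `mem_of_isPureAverage`: first-order condition along `𝔥` + III Lemma 1.3 ⇐ for `U(N)`), so it competes in `H`: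
`Σd²(ḡ,g_i) ≤ Σd²(g₀,g_i) ≤ Σd²(h,g_i)` for all `h ∈ U(N)`.  Everything else RESTRICTS from `U(N)`: Lemma 1.0 and Lemma 1.1
verbatim (distances and norms are the induced ones; (1.11) by the chain rule through the inclusion `𝔥 ⊆ 𝔲(N)`), Lemma 1.2
with the corrections `T_i` ORTHOGONALLY PROJECTED onto `𝔥` (they sum into `𝔥`; `|P T_i| ≤ |T_i|`), Lemma 1.3, Proposition
5.9, uniqueness of `ḡ`; §1's chart data `D.localLog : LocalLog ↥H ↥𝔥` (radius `min(1/100, ρ/2)`, `K = 13`); and then p32's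
group-generic (5.18)–(5.20), (5.25), Theorem 4.3 (pure and modified averages) instantiate for `H`.  HONEST SCOPE: as in all the
cell's instances the distance on `H` is the RESTRICTION of `U(N)`'s bi-invariant length distance (5)–(6) (it is `H`'s intrinsic
one on the chart, not globally in general); Regime 1 only (Theorem 4.2 / (5.26)–(5.40) are not touched); `N`, `H` arbitrary
(`H` trivial allowed).

CONTENTS.  §1 `UNLieSubgroup.isPureAverage_coe_of_pairwise` (TRANSFER), `exists_isPureAverageH`, `existsUnique_isPureAverageH`;
§2 `UNLieSubgroup.ρL` (+ `ρL_pos`, `ρL_le`, `ρL_lt_ρ`), **`logH`** (+ `coe_logH`), `dist_coe`, `lemma10H`, `dist_one_expH`,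
**`localLog : LocalLog ↥D.H ↥D.𝔥`** (+ `localLog_exp/log/ρ`); §3 `lemma11H`, `dist_expH_expH_lt`, **`lemma12H`**, `lemma13H`,
`proposition59AtH`, `proposition59H`; §4 `fourAveragesH`,
`LocalStabilityG.eq525_family_H` / `localStabilityTheorem43_family_H` (+ `_dim4`), `eq525_familyM56_H` /
`localStabilityTheorem43_familyM56_H`; §5 the same for `UNLieSubgroup.ofClosed H hH` (`lemma12_closed`, `localLog_closed`,
`lemma13_closed`, `proposition59_closed`, `eq525_family_closed`, `localStabilityTheorem43_family_closed(_dim4)`).  No `sorry`, no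
new `Prop` definition, no named fact; axioms standard.
-/

namespace Literature.MathematicalPhysics.QuantumFieldTheory.Federbush1986

noncomputable section

open Filter Metric Set NormedSpace
open scoped Topology Matrix.Norms.Frobenius

variable {N : ℕ}

namespace UNLieSubgroup

variable (D : UNLieSubgroup N)

/-! ## §1 Transfer: an `H`-pure average of clustered `H`-valued data is a `U(N)`-pure average -/

/-- Distances in `H` are those of `U(N)`. [cite: Federbush1987PhaseCellVI, (5)–(6) p. 19] -/
theorem dist_coe (a b : D.H) : dist a b = dist (a : UN N) (b : UN N) := rfl

/-- **TRANSFER OF MINIMISERS (every closed locally exponential `H ≤ U(N)`).**  If `g_1, …, g_n ∈ H` are pairwise within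
`δ ≤ 10⁻⁴`, `2δ < ρ`, and `ḡ ∈ H` minimises `Σ_i d²(·, g_i)` over `H`, then `ḡ` minimises it over all of `U(N)`: the `U(N)`-pure
average `g₀` exists (compactness) and lies in `H` (`mem_of_isPureAverage`), so `Σd²(ḡ, g_i) ≤ Σd²(g₀, g_i) ≤ Σd²(h, g_i)` for
every `h ∈ U(N)`. [cite: Federbush1987PhaseCellIII, §1 (1.1)–(1.2), Lemma 1.3 p. 294–296] -/
theorem isPureAverage_coe_of_pairwise {n : ℕ} {gs : Fin n → D.H} {gbar : D.H} {δ : ℝ} (hbar : IsPureAverage gs gbar)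
    (hclose : ∀ i j, dist (gs i) (gs j) < δ) (hδ : δ ≤ 1 / 10000) (hδρ : 2 * δ < D.ρ) :
    IsPureAverage (fun i => (gs i : UN N)) (gbar : UN N) := by
  rcases Nat.eq_zero_or_pos n with rfl | hn
  · intro h
    simp [sumSqDist_def]
  · obtain ⟨g₀, hg₀⟩ := UN.exists_isPureAverage (fun i => (gs i : UN N))
    have hmem : g₀ ∈ D.H :=
      D.mem_of_isPureAverage hn (fun i => (gs i).2) (fun i j => hclose i j) hδ hδρ hg₀
    intro h
    calc sumSqDist (fun i => (gs i : UN N)) (gbar : UN N) = sumSqDist gs gbar := (D.sumSqDist_coe gs gbar).symm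
      _ ≤ sumSqDist gs ⟨g₀, hmem⟩ := hbar _
      _ = sumSqDist (fun i => (gs i : UN N)) g₀ := D.sumSqDist_coe gs ⟨g₀, hmem⟩
      _ ≤ sumSqDist (fun i => (gs i : UN N)) h := hg₀ h

/-- **Pure averages EXIST in `H`** (compactness of the closed subgroup). [cite: Federbush1987PhaseCellIII, (1.1)–(1.2) p. 294–295] -/
theorem exists_isPureAverageH {n : ℕ} (gs : Fin n → D.H) : ∃ gbar : D.H, IsPureAverage gs gbar :=
  exists_isPureAverage_of_compactSpace gs

/-- **The pure average is UNIQUE in Regime 1, in `H`**: pairwise `min(10⁻⁴, ρ/3)`-close data have exactly one pure average in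
`H` (every `H`-pure average is the unique `U(N)`-pure average). [cite: Federbush1987PhaseCellIII, §1 (1.1)–(1.2) p. 294, §3 p. 298, Proposition 5.9 p. 301–302] -/
theorem existsUnique_isPureAverageH {n : ℕ} (hn : 0 < n) (gs : Fin n → D.H)
    (hclose : ∀ i j, dist (gs i) (gs j) < min (1 / 10000) (D.ρ / 3)) : ∃! gbar : D.H, IsPureAverage gs gbar := by
  obtain ⟨gbar, hbar⟩ := D.exists_isPureAverageH gs
  have hδ : min (1 / 10000) (D.ρ / 3) ≤ 1 / 10000 := min_le_left _ _
  have hδρ : 2 * min (1 / 10000) (D.ρ / 3) < D.ρ := by linarith [min_le_right (1 / 10000 : ℝ) (D.ρ / 3), D.ρ_pos]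
  refine ⟨gbar, hbar, fun y hy => ?_⟩
  have h1 : ∀ i j, dist (gs i : UN N) (gs j : UN N) < 1 / 10000 := fun i j => (hclose i j).trans_le hδ
  have hU := UN.existsUnique_isPureAverage hn (fun i => (gs i : UN N)) h1
  exact Subtype.ext (hU.unique (D.isPureAverage_coe_of_pairwise hy hclose hδ hδρ)
    (D.isPureAverage_coe_of_pairwise hbar hclose hδ hδρ))

/-! ## §2 Lemma 1.0 and §1's chart data for `H` -/

/-- The chart radius of `H`: `min(1/100, ρ/2)` (`1/100` = the `U(N)` chart radius). [cite: Federbush1987PhaseCellIII, §1 p. 294–295] -/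
def ρL : ℝ := min (1 / 100) (D.ρ / 2)

/-- [cite: Federbush1987PhaseCellIII, §1 p. 294–295] -/
theorem ρL_pos : 0 < D.ρL := lt_min (by norm_num) (by linarith [D.ρ_pos])

/-- [cite: Federbush1987PhaseCellIII, §1 p. 294–295] -/
theorem ρL_le : D.ρL ≤ 1 / 100 := min_le_left _ _

/-- [cite: Federbush1987PhaseCellIII, §1 p. 294–295] -/
theorem ρL_lt_ρ : D.ρL < D.ρ := by have := min_le_right (1 / 100 : ℝ) (D.ρ / 2); rw [ρL]; linarith [D.ρ_pos]

/-- **The local logarithm of `H`** as a TOTAL function `H → 𝔥`: the `U(N)` logarithm, which lies in `𝔥` within the radius of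
local exponentiality (`log_mem`), extended by `0`. [cite: Federbush1987PhaseCellIII, §1 (1.3), (1.7) p. 295; Federbush1987PhaseCellVI, (5) p. 19] -/
def logH (g : D.H) : D.𝔥 :=
  if h : dist (1 : UN N) (g : UN N) < D.ρ then ⟨UN.logUN (g : UN N), D.log_mem _ g.2 h⟩ else 0

/-- On the radius of local exponentiality `logH` IS `logUN`. [cite: Federbush1987PhaseCellIII, §1 (1.3) p. 295] -/
theorem coe_logH {g : D.H} (hg : dist (1 : D.H) g < D.ρ) : (D.logH g : uN N) = UN.logUN (g : UN N) := by
  have hg' : dist (1 : UN N) (g : UN N) < D.ρ := hg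
  rw [logH, dif_pos hg']

/-- `|e^A| = |A|` in `H` (Lemma 1.0 (1.3), radius `1/16`, from `U(N)`). [cite: Federbush1987PhaseCellIII, Lemma 1.0 (1.3) p. 295] -/
theorem lemma10H : Lemma10Normalisation D.expH (1 / 16) := fun A hA => by
  rw [absG_def, dist_coe, coe_expH]
  have h := UN.lemma10_UN (N := N) (A : uN N) hA
  rwa [absG_def] at h

/-- `d(ε, e^A) = |A|` in `H` for `|A| ≤ 1/16`. [cite: Federbush1987PhaseCellIII, Lemma 1.0 (1.3) p. 295] -/
theorem dist_one_expH {A : D.𝔥} (hA : ‖A‖ ≤ 1 / 16) : dist (1 : D.H) (D.expH A) = ‖A‖ := by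
  rw [dist_coe, coe_expH]
  exact UN.dist_one_expUN hA

/-- **`H` carries §1's chart data** (`exp = expH`, `log = logH`, `ρ = min(1/100, ρ_H/2)`, `K = 13`): every clause is
`UN.localLog`'s read on the subgroup. [cite: Federbush1987PhaseCellIII, §1 Lemma 1.0 (1.3), (1.6)–(1.8) p. 294–295; Federbush1987PhaseCellVI, (5)–(6) p. 19] -/
def localLog : LocalLog D.H D.𝔥 where
  exp := D.expH
  log := D.logH
  ρ := D.ρL
  K := 13
  ρ_pos := D.ρL_pos
  K_nonneg := by norm_num
  exp_log := fun g hg => by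
    apply Subtype.ext
    rw [coe_expH, D.coe_logH (hg.trans_lt D.ρL_lt_ρ)]
    have h := UN.localLog.exp_log (g : UN N) (by rw [UN.localLog_ρ]; exact hg.trans D.ρL_le)
    simpa using h
  norm_log := fun g hg => by
    rw [← Submodule.norm_coe, D.coe_logH (hg.trans_lt D.ρL_lt_ρ), dist_coe]
    have h := UN.localLog.norm_log (g : UN N) (by rw [UN.localLog_ρ]; exact hg.trans D.ρL_le)
    simpa using h
  log_inv := fun g hg => by
    have hg' : dist (1 : D.H) g⁻¹ ≤ D.ρL := by rwa [LocalLog.dist_one_inv]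
    apply Subtype.ext
    rw [Submodule.coe_neg, D.coe_logH (hg'.trans_lt D.ρL_lt_ρ), D.coe_logH (hg.trans_lt D.ρL_lt_ρ), Subgroup.coe_inv]
    have h := UN.localLog.log_inv (g : UN N) (by rw [UN.localLog_ρ]; exact hg.trans D.ρL_le)
    simpa using h
  norm_log_mul_sub_le := fun g h hgh => by
    have hg0 : 0 ≤ dist (1 : D.H) g := dist_nonneg
    have hh0 : 0 ≤ dist (1 : D.H) h := dist_nonneg
    have hg : dist 1 g ≤ D.ρL := by linarith
    have hh : dist 1 h ≤ D.ρL := by linarith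
    have hgh1 : dist (1 : D.H) (g * h) ≤ dist 1 g + dist 1 h := LocalLog.dist_one_mul_le g h
    have hgh' : dist 1 (g * h) ≤ D.ρL := hgh1.trans hgh
    rw [← Submodule.norm_coe, ← Submodule.norm_coe (D.logH g), ← Submodule.norm_coe (D.logH h), Submodule.coe_sub,
      Submodule.coe_add, D.coe_logH (hgh'.trans_lt D.ρL_lt_ρ), D.coe_logH (hg.trans_lt D.ρL_lt_ρ),
      D.coe_logH (hh.trans_lt D.ρL_lt_ρ), Subgroup.coe_mul]
    have h' := UN.localLog.norm_log_mul_sub_le (g : UN N) (h : UN N) (by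
      rw [dist_coe, dist_coe] at hgh; rw [UN.localLog_ρ]; exact hgh.trans D.ρL_le)
    have hK : (UN.localLog (N := N)).K = 13 := rfl
    rw [hK] at h'
    simpa using h'

/-- The chart's exponential is `expH`. [cite: Federbush1987PhaseCellIII, §1 (1.1) p. 294] -/
@[simp] theorem localLog_exp : D.localLog.exp = D.expH := rfl

/-- The chart's logarithm is `logH`. [cite: Federbush1987PhaseCellIII, §1 (1.3) p. 295] -/
@[simp] theorem localLog_log : D.localLog.log = D.logH := rfl

/-- The chart's radius. [cite: Federbush1987PhaseCellIII, §1 p. 294] -/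
@[simp] theorem localLog_ρ : D.localLog.ρ = D.ρL := rfl

/-! ## §3 Lemmas 1.1, 1.2, 1.3 and Proposition 5.9 for `H` -/

/-- **Lemma 1.1 for `H`** ((1.4)–(1.5), differentiability, (1.11)) — p12's `UN.lemma11_UN` on the subgroup: values agree, and the
correction `F(·, B)` on `𝔥` is p12's composed with the inclusion `ι : 𝔥 →L[ℝ] 𝔲(N)` (`‖ι‖ ≤ 1`), so (1.11) by the chain rule.
[cite: Federbush1987PhaseCellIII, Lemma 1.1 (1.4)–(1.5), (1.11) p. 295] -/
theorem lemma11H : Lemma11 D.expH := by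
  obtain ⟨ρ, hρ, c, h⟩ := UN.lemma11_UN (N := N)
  obtain ⟨ι, hιv, hιn⟩ : ∃ ι : D.𝔥 →L[ℝ] uN N, (∀ y, ι y = (y : uN N)) ∧ ‖ι‖ ≤ 1 :=
    ⟨D.𝔥.subtypeL, fun _ => rfl, Submodule.norm_subtypeL_le _⟩
  refine ⟨ρ, hρ, c, fun A B hA hB => ?_⟩
  have hA' : ‖(A : uN N)‖ < ρ := by rwa [Submodule.norm_coe]
  have hB' : ‖(B : uN N)‖ < ρ := by rwa [Submodule.norm_coe]
  obtain ⟨h1, h2, h3⟩ := h (A : uN N) (B : uN N) hA' hB'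
  have hval : dist (D.expH A) (D.expH B) ^ 2 - ‖B - A‖ ^ 2 =
      dist (expUN (A : uN N)) (expUN (B : uN N)) ^ 2 - ‖(B : uN N) - (A : uN N)‖ ^ 2 := by
    rw [dist_coe, coe_expH, coe_expH, ← Submodule.norm_coe, Submodule.coe_sub]
  have hF : (fun A' : D.𝔥 => dist (D.expH A') (D.expH B) ^ 2 - ‖B - A'‖ ^ 2) =
      (fun Y : uN N => dist (expUN Y) (expUN (B : uN N)) ^ 2 - ‖(B : uN N) - Y‖ ^ 2) ∘ ι := by
    funext A'
    simp only [Function.comp_apply]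
    rw [hιv, dist_coe, coe_expH, coe_expH, ← Submodule.norm_coe, Submodule.coe_sub]
  have hιA : ι A = (A : uN N) := hιv A
  have h2' : DifferentiableAt ℝ (fun Y : uN N => dist (expUN Y) (expUN (B : uN N)) ^ 2 - ‖(B : uN N) - Y‖ ^ 2) (ι A) := by
    rw [hιA]; exact h2
  have hcomp : HasFDerivAt ((fun Y : uN N => dist (expUN Y) (expUN (B : uN N)) ^ 2 - ‖(B : uN N) - Y‖ ^ 2) ∘ ι)
      ((fderiv ℝ (fun Y : uN N => dist (expUN Y) (expUN (B : uN N)) ^ 2 - ‖(B : uN N) - Y‖ ^ 2) (ι A)).comp ι) A :=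
    h2'.hasFDerivAt.comp A ι.hasFDerivAt
  refine ⟨by rw [hval]; exact h1, by rw [hF]; exact hcomp.differentiableAt, ?_⟩
  rw [hF, hcomp.fderiv, ← Submodule.norm_coe, ← Submodule.norm_coe A]
  calc ‖(fderiv ℝ (fun Y : uN N => dist (expUN Y) (expUN (B : uN N)) ^ 2 - ‖(B : uN N) - Y‖ ^ 2) (ι A)).comp ι‖
      ≤ ‖fderiv ℝ (fun Y : uN N => dist (expUN Y) (expUN (B : uN N)) ^ 2 - ‖(B : uN N) - Y‖ ^ 2) (ι A)‖ * ‖ι‖ :=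
        ContinuousLinearMap.opNorm_comp_le _ _
    _ ≤ c * (‖(B : uN N)‖ ^ 3 + ‖(A : uN N)‖ ^ 3) * 1 := by
        rw [hιA]
        exact mul_le_mul h3 hιn (norm_nonneg ι) ((norm_nonneg _).trans h3)
    _ = c * (‖(B : uN N)‖ ^ 3 + ‖(A : uN N)‖ ^ 3) := mul_one _

/-- The data `e^{A_i}`, `|A_i| < r ≤ 1/16`, are pairwise `2r`-close in `H`. [cite: Federbush1987PhaseCellIII, Lemma 1.0 (1.3), Lemma 5.1 p. 295, 299] -/
theorem dist_expH_expH_lt {r : ℝ} (hr : r ≤ 1 / 16) {A B : D.𝔥} (hA : ‖A‖ < r) (hB : ‖B‖ < r) :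
    dist (D.expH A) (D.expH B) < 2 * r :=
  calc dist (D.expH A) (D.expH B) ≤ dist (D.expH A) 1 + dist 1 (D.expH B) := dist_triangle _ _ _
    _ = ‖A‖ + ‖B‖ := by rw [dist_comm, D.dist_one_expH (hA.le.trans hr), D.dist_one_expH (hB.le.trans hr)]
    _ < 2 * r := by linarith

/-- **Lemma 1.2 for `H`** — `Lemma12 D.expH`: for `A_i, x ∈ 𝔥` small with `e^x` a pure average of the `e^{A_i}` IN `H`,
`x = (1/n)ΣA_i + (1/n)ΣT_i` with `T_i ∈ 𝔥`, `|T_i| ≤ c(|x|³ + |A_i|³)` (p12's constant): transfer of the minimiser to `U(N)`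
(§1), p12's Lemma 1.2 there, and ORTHOGONAL projection of the corrections onto `𝔥` (they sum to `n x − ΣA_i ∈ 𝔥`; the
projection does not increase norms). [cite: Federbush1987PhaseCellIII, Lemma 1.2 (1.10) p. 295] -/
theorem lemma12H : Lemma12 D.expH := by
  obtain ⟨ρ₁, hρ₁, c, h12⟩ := UN.lemma12_UN (N := N)
  haveI : CompleteSpace D.𝔥 := FiniteDimensional.complete ℝ D.𝔥
  -- radius: p12's, the transfer's clustering (`2r ≤ 10⁻⁴`, `4r < ρ`), and Lemma 1.0's `1/16`
  set r : ℝ := min ρ₁ (min (1 / 20000) (D.ρ / 5)) with hr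
  have hr0 : 0 < r := lt_min hρ₁ (lt_min (by norm_num) (by linarith [D.ρ_pos]))
  refine ⟨r, hr0, c, fun n hn A x hA hx hbar => ?_⟩
  have hrρ₁ : r ≤ ρ₁ := min_le_left _ _
  have hr2 : r ≤ 1 / 20000 := (min_le_right _ _).trans (min_le_left _ _)
  have hrρ : r ≤ D.ρ / 5 := (min_le_right _ _).trans (min_le_right _ _)
  have hAρ : ∀ i, ‖(A i : uN N)‖ < ρ₁ := fun i => by rw [Submodule.norm_coe]; exact (hA i).trans_le hrρ₁
  have hxρ : ‖(x : uN N)‖ < ρ₁ := by rw [Submodule.norm_coe]; exact hx.trans_le hrρ₁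
  -- the `H` minimiser is a `U(N)` minimiser
  have hclose : ∀ i j, dist (D.expH (A i)) (D.expH (A j)) < 2 * r := fun i j =>
    D.dist_expH_expH_lt (hr2.trans (by norm_num)) (hA i) (hA j)
  have hbarU : IsPureAverage (fun i => expUN (A i : uN N)) (expUN (x : uN N)) := by
    have h := D.isPureAverage_coe_of_pairwise (gs := fun i => D.expH (A i)) (gbar := D.expH x) hbar hclose
      (by linarith) (by linarith [D.ρ_pos])
    simpa using h
  obtain ⟨T, hxT, hT⟩ := h12 n hn (fun i => (A i : uN N)) (x : uN N) hAρ hxρ hbarU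
  -- project the corrections onto `𝔥`
  set P := D.𝔥.orthogonalProjectionOnto with hP
  refine ⟨fun i => P (T i), ?_, fun i => ?_⟩
  · have hPx : P (x : uN N) = x := Submodule.orthogonalProjectionOnto_mem_subspace_eq_self x
    have hPA : ∀ i, P (A i : uN N) = A i := fun i => Submodule.orthogonalProjectionOnto_mem_subspace_eq_self (A i)
    have h1 := congrArg P hxT
    rw [hPx, map_add, map_smul, map_smul, map_sum, map_sum] at h1
    simp only [hPA] at h1
    exact h1
  · calc ‖P (T i)‖ ≤ ‖T i‖ := D.𝔥.norm_orthogonalProjectionOnto_apply_le (T i)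
      _ ≤ c * (‖(x : uN N)‖ ^ 3 + ‖(A i : uN N)‖ ^ 3) := hT i
      _ = c * (‖x‖ ^ 3 + ‖A i‖ ^ 3) := by rw [Submodule.norm_coe, Submodule.norm_coe]

/-- **Lemma 1.3 for `H`** — `Lemma13 D.expH`: «x = 0 ⇔ ΣA_i = 0» for `H`-pure averages of small data (transfer to `U(N)` + p12's
`UN.lemma13_UN`). [cite: Federbush1987PhaseCellIII, Lemma 1.3 (1.12) p. 295–296] -/
theorem lemma13H : Lemma13 D.expH := by
  obtain ⟨ρ₁, hρ₁, h13⟩ := UN.lemma13_UN (N := N)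
  set r : ℝ := min ρ₁ (min (1 / 20000) (D.ρ / 5)) with hr
  have hr0 : 0 < r := lt_min hρ₁ (lt_min (by norm_num) (by linarith [D.ρ_pos]))
  refine ⟨r, hr0, fun n hn A x hA hx hbar => ?_⟩
  have hrρ₁ : r ≤ ρ₁ := min_le_left _ _
  have hr2 : r ≤ 1 / 20000 := (min_le_right _ _).trans (min_le_left _ _)
  have hrρ : r ≤ D.ρ / 5 := (min_le_right _ _).trans (min_le_right _ _)
  have hAρ : ∀ i, ‖(A i : uN N)‖ < ρ₁ := fun i => by rw [Submodule.norm_coe]; exact (hA i).trans_le hrρ₁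
  have hxρ : ‖(x : uN N)‖ < ρ₁ := by rw [Submodule.norm_coe]; exact hx.trans_le hrρ₁
  have hclose : ∀ i j, dist (D.expH (A i)) (D.expH (A j)) < 2 * r := fun i j =>
    D.dist_expH_expH_lt (hr2.trans (by norm_num)) (hA i) (hA j)
  have hbarU : IsPureAverage (fun i => expUN (A i : uN N)) (expUN (x : uN N)) := by
    have h := D.isPureAverage_coe_of_pairwise (gs := fun i => D.expH (A i)) (gbar := D.expH x) hbar hclose
      (by linarith) (by linarith [D.ρ_pos])
    simpa using h
  have key := h13 n hn (fun i => (A i : uN N)) (x : uN N) hAρ hxρ hbarU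
  have e0 : ∀ y : D.𝔥, y = 0 ↔ (y : uN N) = 0 := fun y =>
    ⟨fun h => by rw [h, Submodule.coe_zero], fun h => Subtype.ext (h.trans Submodule.coe_zero.symm)⟩
  rw [e0 x, key, e0, Submodule.coe_sum]

/-- **Proposition 5.9 at a given `ε₁` for `H`** (`ε₁ ≤ 10⁻⁴`, `2ε₁ < ρ`): `d(g_i, g_j) < ε₁ ⇒ d(ḡ, g_i) < ε₁` for every pure
average `ḡ ∈ H` (transfer + p12's `UN.proposition59At_UN`). [cite: Federbush1987PhaseCellIII, Proposition 5.9 (5.16) p. 301–302] -/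
theorem proposition59AtH {ε₁ : ℝ} (hε : ε₁ ≤ 1 / 10000) (hερ : 2 * ε₁ < D.ρ) : Proposition59At D.H ε₁ := by
  intro n gs gbar hbar hclose i
  have hcoe := D.isPureAverage_coe_of_pairwise hbar hclose hε hερ
  exact UN.proposition59At_UN (N := N) hε n (fun j => (gs j : UN N)) (gbar : UN N) hcoe (fun j k => hclose j k) i

/-- **Proposition 5.9 for `H`** (`ε₀ = min(10⁻⁴, ρ/3)`): «d(g_i, g_j) < ε₁ ⇒ d(ḡ, g_i) < ε₁», uniformly in `n`.
[cite: Federbush1987PhaseCellIII, Proposition 5.9 (5.16) p. 301–302] -/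
theorem proposition59H : Proposition59 D.H :=
  ⟨min (1 / 10000) (D.ρ / 3), lt_min (by norm_num) (by linarith [D.ρ_pos]), fun _ _ hle =>
    D.proposition59AtH (hle.trans (min_le_left _ _))
      (by linarith [hle.trans (min_le_right _ _), D.ρ_pos])⟩

/-! ## §4 The Regime-1 chain for `H`: (5.18)–(5.20), (5.25), Theorem 4.3 (pure and modified averages) -/

/-- **Steps 1–3 (5.18)–(5.20) with the corrections b), c) for `G = H`** (`LocalLog.fourAverages` at `D.localLog`, `D.lemma12H`).
[cite: Federbush1987PhaseCellIII, (5.18)–(5.20) and a)–d) p. 302–303] -/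
theorem fourAveragesH : ∃ δ₀ > (0 : ℝ), ∃ C : ℝ, ∀ (m : ℕ), 0 < m →
    ∀ (g : Fin 4 → Fin m → D.H) (ℓ : Fin 4 → Fin m → D.𝔥) (gbar : Fin 4 → D.H) (E δ : ℝ),
      (∀ k, IsPureAverage (g k) (gbar k)) → (∀ k i, dist 1 (g k i) ≤ δ) → δ ≤ δ₀ →
      (∀ k i, ‖D.logH (g k i) - ℓ k i‖ ≤ E) →
      ‖D.logH (gbar 0 * gbar 1 * (gbar 2)⁻¹ * (gbar 3)⁻¹) -
          (m : ℝ)⁻¹ • ∑ i, (ℓ 0 i + ℓ 1 i - ℓ 2 i - ℓ 3 i)‖ ≤ 4 * E + C * δ ^ 2 :=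
  D.localLog.fourAverages D.lemma12H

end UNLieSubgroup

namespace LocalStabilityG

variable (D : UNLieSubgroup N)

/-- **(5.25) «the basic result» PROVED for the model instance `G = H`, every closed locally exponential `H ≤ U(N)`, every
dimension `d + 2`** (pure averages (1.2)). [cite: Federbush1987PhaseCellIII, (5.25) and Parameter Condition 5.10 p. 303] -/
theorem eq525_family_H (d M : ℕ) (hM : 0 < M) (Alf : ℝ → Cfg D.H d M → ℝ) (hAlf : ∀ a U, 0 ≤ Alf a U) :
    TwoLevelScheme.Eq525 (family d M hM Alf hAlf) :=
  eq525_family D.localLog d M hM D.lemma12H Alf hAlf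

/-- **Local Stability Theorem 4.3 (4.5) PROVED for the model instance `G = H`, every closed locally exponential `H ≤ U(N)`,
every dimension `d + 2`.** [cite: Federbush1987PhaseCellIII, Local Stability Theorem 4.3 (4.5) p. 299; (5.25) p. 303] -/
theorem localStabilityTheorem43_family_H (d M : ℕ) (hM : 0 < M) (Alf : ℝ → Cfg D.H d M → ℝ) (hAlf : ∀ a U, 0 ≤ Alf a U) :
    TwoLevelScheme.LocalStabilityTheorem43 (family d M hM Alf hAlf) :=
  localStabilityTheorem43_family D.localLog d M hM D.lemma12H Alf hAlf

/-- (5.25) for `G = H` in print's dimension four. [cite: Federbush1987PhaseCellIII, (5.25) p. 303; §4 p. 298] -/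
theorem eq525_family_H_dim4 (M : ℕ) (hM : 0 < M) (Alf : ℝ → Cfg D.H 2 M → ℝ) (hAlf : ∀ a U, 0 ≤ Alf a U) :
    TwoLevelScheme.Eq525 (family 2 M hM Alf hAlf) :=
  eq525_family_H D 2 M hM Alf hAlf

/-- Local Stability Theorem 4.3 for `G = H` in print's dimension four. [cite: Federbush1987PhaseCellIII, Local Stability Theorem 4.3 (4.5) p. 299; §4 p. 298] -/
theorem localStabilityTheorem43_family_H_dim4 (M : ℕ) (hM : 0 < M) (Alf : ℝ → Cfg D.H 2 M → ℝ)
    (hAlf : ∀ a U, 0 ≤ Alf a U) : TwoLevelScheme.LocalStabilityTheorem43 (family 2 M hM Alf hAlf) :=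
  localStabilityTheorem43_family_H D 2 M hM Alf hAlf

/-- **(5.25) with Federbush's modified averages (3.8) for `G = H`**, every dimension `d + 2 ≤ 150` (closeness from Lemma 5.6).
[cite: Federbush1987PhaseCellIII, (5.25) p. 303; (3.8) p. 297–298; Lemma 5.6 (5.13) p. 301] -/
theorem eq525_familyM56_H (d M : ℕ) (hM : 0 < M) (hd : d + 2 ≤ 150) (Alf : ℝ → Cfg D.H d M → ℝ)
    (hAlf : ∀ a U, 0 ≤ Alf a U) : TwoLevelScheme.Eq525 (familyM d M hM Alf hAlf) :=
  eq525_familyM56 D.localLog d M hM D.lemma12H hd Alf hAlf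

/-- **Local Stability Theorem 4.3 with the modified averages (3.8) for `G = H`**, every dimension `d + 2 ≤ 150`.
[cite: Federbush1987PhaseCellIII, Local Stability Theorem 4.3 (4.5) p. 299; (3.8) p. 297–298; Lemma 5.6 (5.13) p. 301] -/
theorem localStabilityTheorem43_familyM56_H (d M : ℕ) (hM : 0 < M) (hd : d + 2 ≤ 150) (Alf : ℝ → Cfg D.H d M → ℝ)
    (hAlf : ∀ a U, 0 ≤ Alf a U) : TwoLevelScheme.LocalStabilityTheorem43 (familyM d M hM Alf hAlf) :=
  localStabilityTheorem43_familyM56 D.localLog d M hM D.lemma12H hd Alf hAlf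

end LocalStabilityG

/-! ## §5 Every CLOSED subgroup `H ≤ U(N)` (Cartan–von Neumann, `UNLieSubgroup.ofClosed`) -/

section Closed

variable (H : Subgroup (UN N)) (hH : IsClosed (H : Set (UN N)))

/-- §1's chart data for an arbitrary closed subgroup of `U(N)`. [cite: Federbush1987PhaseCellIII, §1 p. 294–295; Federbush1987PhaseCellVI, (5) p. 19] -/
def localLog_closed : LocalLog (UNLieSubgroup.ofClosed H hH).H (UNLieSubgroup.ofClosed H hH).𝔥 :=
  (UNLieSubgroup.ofClosed H hH).localLog

/-- **Lemma 1.2 for every closed subgroup of `U(N)`.** [cite: Federbush1987PhaseCellIII, Lemma 1.2 (1.10) p. 295] -/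
theorem lemma12_closed : Lemma12 (UNLieSubgroup.ofClosed H hH).expH := (UNLieSubgroup.ofClosed H hH).lemma12H

/-- **Lemma 1.3 for every closed subgroup of `U(N)`.** [cite: Federbush1987PhaseCellIII, Lemma 1.3 (1.12) p. 295–296] -/
theorem lemma13_closed : Lemma13 (UNLieSubgroup.ofClosed H hH).expH := (UNLieSubgroup.ofClosed H hH).lemma13H

/-- **Proposition 5.9 for every closed subgroup of `U(N)`** (as a type: `↥H`). [cite: Federbush1987PhaseCellIII, Proposition 5.9 (5.16) p. 301–302] -/
theorem proposition59_closed : Proposition59 (UNLieSubgroup.ofClosed H hH).H := (UNLieSubgroup.ofClosed H hH).proposition59H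

/-- **(5.25) for the model instance `G = H`, `H` ANY closed subgroup of `U(N)`, every dimension.**
[cite: Federbush1987PhaseCellIII, (5.25) p. 303] -/
theorem LocalStabilityG.eq525_family_closed (d M : ℕ) (hM : 0 < M) (Alf : ℝ → Cfg (UNLieSubgroup.ofClosed H hH).H d M → ℝ)
    (hAlf : ∀ a U, 0 ≤ Alf a U) : TwoLevelScheme.Eq525 (LocalStabilityG.family d M hM Alf hAlf) :=
  LocalStabilityG.eq525_family_H _ d M hM Alf hAlf

/-- **Local Stability Theorem 4.3 for the model instance `G = H`, `H` ANY closed subgroup of `U(N)`, every dimension.**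
[cite: Federbush1987PhaseCellIII, Local Stability Theorem 4.3 (4.5) p. 299] -/
theorem LocalStabilityG.localStabilityTheorem43_family_closed (d M : ℕ) (hM : 0 < M)
    (Alf : ℝ → Cfg (UNLieSubgroup.ofClosed H hH).H d M → ℝ) (hAlf : ∀ a U, 0 ≤ Alf a U) :
    TwoLevelScheme.LocalStabilityTheorem43 (LocalStabilityG.family d M hM Alf hAlf) :=
  LocalStabilityG.localStabilityTheorem43_family_H _ d M hM Alf hAlf

/-- Local Stability Theorem 4.3 for `G = H` closed in `U(N)`, print's dimension four.
[cite: Federbush1987PhaseCellIII, Local Stability Theorem 4.3 (4.5) p. 299; §4 p. 298] -/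
theorem LocalStabilityG.localStabilityTheorem43_family_closed_dim4 (M : ℕ) (hM : 0 < M)
    (Alf : ℝ → Cfg (UNLieSubgroup.ofClosed H hH).H 2 M → ℝ) (hAlf : ∀ a U, 0 ≤ Alf a U) :
    TwoLevelScheme.LocalStabilityTheorem43 (LocalStabilityG.family 2 M hM Alf hAlf) :=
  LocalStabilityG.localStabilityTheorem43_family_H _ 2 M hM Alf hAlf

end Closed

end

end Literature.MathematicalPhysics.QuantumFieldTheory.Federbush1986
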